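import Summits.BirchSwinnertonDyer.BirchSwinnertonDyer.Theses.PAdicOrderV2
import Summits.BirchSwinnertonDyer.BirchSwinnertonDyer.Theses.PAdicOrder
import Summits.BirchSwinnertonDyer.BirchSwinnertonDyer.Theorems.PAdicOrderRankOneR4.Negative.CounterexampleShape
import Literature.NumberTheory.EllipticCurves.CanonicalPAdicHeightHolds
import Literature.Barriers.BirchSwinnertonDyer.PAdicHeightNondegeneracy

/-!
# Line `height-side-schneider` for crux `PAdicOrderV2.PAdicOrderRankOneR4` (stmt-BirchSwinnertonDyer-0515)

Skeleton registered by the crux-strategist (wall-breaker seat `cstrat-stmt-BirchSwinnertonDyer-0515-p1`,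
2026-08-17) after the opening chain exhausted (line `Sketch` = idea `tame-shadow-derived-kato` DEAD at K2
by Fricke rigidity; ideas `sigma-transcendence`, `hida-weight-edge`, `level-raising-second-coefficient`,
`tate-twist-decay-beilinson-kato` failed triage; ideate census r2-k4: nine further levers reduce to one
scalar). Card: `Lines/height_side_schneider.md`; census: `STRATEGY-CENSUS.md` (same directory). Slug `height-side-schneider`
(the workfile store renames `-` to `_` for the Lean module).

## The crux (recall)

`PAdicOrderRankOneR4`: for `W/ℚ` elliptic and globally minimal, `p` good ordinary (`IsOrdinaryAt W p`, every
`p`, `2` and `3` included), `W.analyticRank = 1`, and `f ∈ S₂(Γ₀(N))` with `IsNewformOf W f`: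
`(padicLFunction f (unitRoot W p)).order = 1`.

## What this line is — and is not

It is the CANONICAL REDUCTION of the crux to rank-one Schneider non-degeneracy, typed over the tree's
canonical cyclotomic `p`-adic height, which became available unconditionally on 2026-08-16
(`WeierstrassCurve.exists_isCanonical_holds`, `CanonicalPAdicHeightHolds.lean`: the Mazur–Tate sigma pair
exists uniquely, Blakestad–Grant 2023), AFTER route `PAdicOrderV2` had parked its height-side Schneider
node "for want of `exists_isCanonical`" (route header, NOT DECOMPOSED YET (ii)). It does NOT claim an
engine for its hardest stub: the strategist's census (`STRATEGY-CENSUS.md`) records why every transfer /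
strengthening / negation attempt on that stub lands on a `p`-adic transcendence statement for values of
the Mazur–Tate sigma function of a NON-CM curve (Bertrand 1982 settles the CM case by Baker's method on
`Ext(E, 𝔾_m²)`, which needs the unit-root splitting to be algebraic, i.e. CM by Serre–Tate). The line is
registered so that

* the KNOWN part of the crux (stub R below: Perrin-Riou 1987 Thm 1.3 + Gross–Zagier 1986 + Kolyvagin 1990
  + Friedberg–Hoffstein 1995 + MTT interpolation for the twist + the `K → ℚ` restriction of the canonical
  height) is separated, as ONE checkable statement, from
* the OPEN core (stub H: `ĥ_p(P) ≠ 0` for every admissible point of an analytic-rank-one curve at a good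
  ordinary `p ≥ 5` — Mazur–Stein–Tate 2006 Conj. 1.1 in rank one; "not known to be non-zero",
  Jetchev–Skinner–Wan 2017 §1.2; "only known … CM … supersingular", Burungale–Disegni 2021 p. 3), stated
  over `WeierstrassCurve.canonicalPAdicHeight = log_p(den x) − 2 log_p σ_p(−x/y)` (Stein–Wuthrich 2013
  (4.1)), the object on which the one known proof technique (Bertrand) and the numerical refutation
  channel (MST 2006 algorithm) both operate, and from
* the SMALL-PRIME RESIDUE `p ∈ {2, 3}` (stub S), which the crux's signature admits but no printed theory
  reaches (no Mazur–Tate sigma function / canonical height in the tree below `5`, no Kato at `2`); route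
  kill-criterion (c) already grades a refutation there `misstated` with repair `5 ≤ p →`.

      PAdicOrderRankOneR4  ⇐  coeff₁ L_p(E,T) ≠ 0          [landed `Negative.order_eq_one_iff_coeff_one_ne_zero`:
                                                              `1 ≤ ord` (S1 p97073) + parity ⇒ `ord = 1 ↔ c₁ ≠ 0`]
        coeff₁ ≠ 0, 5 ≤ p  ⇐  stub_padicGrossZagierReduction (R)  applied to  stub_schneiderRankOne (H)
        coeff₁ ≠ 0, p < 5  =  stub_smallPrimes (S)

Disproof.lean honoured: H1 (`IsOrdinaryAt`) and H4 (`IsNewformOf`) are hypotheses of R and S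
(`order_ne_one_of_dvd_frobeniusTrace`, `withoutNewform_false_of`); H2 (`analyticRank = 1`) is a hypothesis of
all three; §3a `height_ne_zero_of_PAdicOrderRankOneR4` is the CONVERSE direction of R (crux ⇒ Heegner height
≠ 0, mod PR87) — R is PR87 read forwards; §3b: a kill of H is an admissible `P` with
`σ_p(z_P)² · p^{-2 ord_p e(P)} / e'(P)² ∈ μ_{p-1}` (`e = e' p^{ord_p e}` the square root of `den x(P)`), and by
`order_ne_one_iff_three_le_order` it forces `ord_T L_p ≥ 3`. No stub is an instance of a landed Negative
lemma; none quantifies over the junk regimes of §1.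
-/

set_option linter.unusedVariables false
set_option linter.dupNamespace false

noncomputable section

namespace Summit.BirchSwinnertonDyer.BirchSwinnertonDyer.Cruxes.PAdicOrderRankOneR4.HeightSide

open CongruenceSubgroup PowerSeries
open Summit.BirchSwinnertonDyer.BirchSwinnertonDyer.Theses.PAdicOrderV2
open Literature.NumberTheory.EllipticCurves Literature.NumberTheory.EllipticCurves.ModularForms

/-! ## Registered stubs -/

/-- **H · `stub_schneiderRankOne` — rank-one Schneider non-degeneracy, pointwise admissible form (the
hardest stub; OPEN for non-CM curves).** For `W/ℚ` elliptic and globally minimal, `p ≥ 5` good ordinary,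
`W.analyticRank = 1`: every ADMISSIBLE point `P ∈ E(ℚ)` (non-torsion, `P ∈ E₁(ℚ_p)`, `z(P)` in the sigma disc,
non-singular reduction at every prime — `WeierstrassCurve.IsAdmissible`) has non-zero canonical cyclotomic
`p`-adic height `ĥ_p(P) = log_p(den x(P)) − 2 log_p σ_p(−x/y) ≠ 0` (`WeierstrassCurve.canonicalPAdicHeight`,
Stein–Wuthrich normalisation; `σ_p` the Mazur–Tate sigma function, which exists uniquely here:
`mazur_tate_sigma_existsUnique_holds`). Since `rank E(ℚ) = 1` (Gross–Zagier–Kolyvagin) and `ĥ_p` is the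
quadratic form of THE canonical datum on admissible points (`exists_isCanonical_holds`,
`exists_admissible_nsmul_holds`), this is `Reg_p(E) ≠ 0`, i.e. `WeierstrassCurve.SchneiderConjecture D` for
the canonical `D` in rank one (Mazur–Stein–Tate 2006 Conj. 1.1; Schneider 1982 §1). KNOWN: CM curves
(Bertrand 1982, Cor. 4: Baker's method on `Ext(E, 𝔾_m²)`; at a split `p` Bernardi's height with the CM value
of `s₂` is the canonical one); supersingular `p` (not in range here). OPEN: non-CM `E` ("the `p`-adic height
of the Heegner point is then not known to be non-zero", Jetchev–Skinner–Wan 2017 §1.2; Burungale–Disegni 2021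
p. 3). A counterexample is an admissible `P` with `σ_p(z_P)²/(den' x(P) · p^{2 ord_p e(P)}) ∈ μ_{p−1}`
(`den'` the prime-to-`p` part), never observed (MST 2006; SW 2013 §8; cdisprove j016547/j016704; ideator
j015924: 1375 pairs). Research-level (crux-sized); the strategist's census records why no engine is known.
[cite: MazurSteinTate2006, Conj. 1.1] [cite: Bertrand1982, Cor. 4] [cite: JetchevSkinnerWan2017, §1.2] -/
theorem stub_schneiderRankOne :
    ∀ (W : WeierstrassCurve ℚ) [W.IsElliptic] [W.IsGloballyMinimal] (p : ℕ) [Fact p.Prime],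
      5 ≤ p → IsOrdinaryAt W p → W.analyticRank = 1 →
      ∀ P : W.toAffine.Point, W.IsAdmissible p P → W.canonicalPAdicHeight p P ≠ 0 := by
  sorry

/-- **R · `stub_padicGrossZagierReduction` — the rank-one `p`-adic Gross–Zagier reduction (KNOWN in print,
size XL; Perrin-Riou 1987 read forwards).** For `W/ℚ` elliptic and globally minimal, `p ≥ 5` good ordinary,
`W.analyticRank = 1`, `f` with `IsNewformOf W f`: IF every admissible point has `ĥ_p(P) ≠ 0` THEN
`L_p'(E, 0) ≠ 0`, i.e. `coeff₁ L_p(f, α_p, T) ≠ 0`. Printed chain: (1) `rank E(ℚ) = 1`, `Ш(E/ℚ)` finite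
(Gross–Zagier 1986 Thm I.6.3 + Kolyvagin 1990), generator `P₀`, some multiple `m P₀` admissible
(`exists_admissible_nsmul_holds`), so the hypothesis gives `ĥ_p(P₀) ≠ 0` by quadraticity
(`exists_isCanonical_holds`); (2) choose `K` imaginary quadratic with the Heegner hypothesis for `N_E`, `d_K` odd
and coprime to `N_E`, `p` split in `K`, and `L(E^{(d_K)}, 1) ≠ 0` (Friedberg–Hoffstein 1995 Thm B / Bump–
Friedberg–Hoffstein 1990 / Murty–Murty 1991: infinitely many such `d_K` with prescribed local behaviour at the
finitely many primes `p`, `ℓ ∣ N_E`); (3) the Heegner point `P_K` is non-torsion and `P_K ≐ m' P₀` modulo torsion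
and `E^{(d_K)}(ℚ)` (finite), so `⟨P_K, P_K⟩_{p,K} = 2 m'² ĥ_p(P₀) ≠ 0` for THE canonical `K`-datum
(`exists_isCanonicalK_holds`, restriction `isCanonicalK_restrictsTo`: sum over the two places above `p`);
(4) Perrin-Riou 1987 Thm 1.3 (tree fact `perrinRiou_padicGrossZagier`, corollary `order_eq_one_iff`):
`ord_T L_p(E/K, T) = 1`; (5) `L_p(E/K,T) = L_p(f,α,T) · L_p(g,α',T)` (`padicLFunctionEK`) and the twist factor is a
unit because `L_p(g, α', 0) = (1 − α'⁻¹)² L(E^{(d_K)},1)/Ω ≠ 0` (MTT interpolation, discharged in the tree for the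
curve itself: `isPAdicLFunctionOf_padicLFunction_holds`; `α' ≠ 1` by Hasse), hence `ord_T L_p(f,α,T) = 1`, i.e.
`coeff₁ ≠ 0` given `coeff₀ = 0` (S1, landed p97073). Why it might still fail AS TYPED: only a normalisation slip
between the tree's `canonicalPAdicHeightK` (BCS 2015 (4.1)) and Perrin-Riou's `⟨ , ⟩_p` (her §1.2), which would
misplace a non-zero constant, not create a zero. Converse direction landed: `Negative.height_ne_zero_of_PAdicOrderRankOneR4`.
[cite: PerrinRiou1987, Thm. 1.3] [cite: GrossZagierInvent1986, Thm. I.6.3] [cite: GreenbergLNM1716, §4 p. 111] -/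
theorem stub_padicGrossZagierReduction :
    ∀ (W : WeierstrassCurve ℚ) [W.IsElliptic] [W.IsGloballyMinimal] (p : ℕ) [Fact p.Prime],
      5 ≤ p → IsOrdinaryAt W p → W.analyticRank = 1 →
      (∀ P : W.toAffine.Point, W.IsAdmissible p P → W.canonicalPAdicHeight p P ≠ 0) →
      ∀ {N : ℕ} [NeZero N] (f : CuspForm (Gamma0 N) 2), IsNewformOf W f →
        coeff 1 (padicLFunction f (unitRoot W p : ℚ_[p])) ≠ 0 := by
  sorry

/-- **S · `stub_smallPrimes` — the small-prime residue `p ∈ {2, 3}` of the crux.** For `W/ℚ` elliptic and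
globally minimal, `p < 5` good ordinary, `W.analyticRank = 1`, `f` with `IsNewformOf W f`: `coeff₁ L_p(f,α_p,T) ≠ 0`.
This is the crux's own special case at the two primes where neither the Mazur–Tate sigma function / canonical
height of the tree (`mazur_tate_sigma_existsUnique`, `exists_isCanonical`: `5 ≤ p`) nor Perrin-Riou 1987 / Kato
2004 (`p` odd, resp. `p ≥ 5` in the tree's vendoring) is available, kept as a separate stub ONLY because the
crux's signature admits these primes; route kill-criterion (c) pre-classifies a refutation here as `misstated`
(repair: the same statement with `5 ≤ p →`, filed as a new item), after which this stub is moot. Evidence that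
it is true: cdisprove kit jobs j016547/j016704 — all 27 rank-one pairs at `p = 2` (`N ≤ 330`, the PARI `a_2 = +1`
artefact diagnosed by exact Riemann sums) and all 75 at `p = 3` have `coeff₁ ≠ 0`. Honest objects at `p = 2`
(`unitRoot` by Hensel, `cyclotomicGenerator 2 = 5`, `torsionOrder 2 = 2`: Disproof §0). No printed theory;
every ordinary `p = 2` is anomalous. [cite: SteinWuthrich2013, §3 and §8] [cite: MazurTateTeitelbaum1986Invent, §I.10–I.14] -/
theorem stub_smallPrimes :
    ∀ (W : WeierstrassCurve ℚ) [W.IsElliptic] [W.IsGloballyMinimal] (p : ℕ) [Fact p.Prime],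
      p < 5 → IsOrdinaryAt W p → W.analyticRank = 1 →
      ∀ {N : ℕ} [NeZero N] (f : CuspForm (Gamma0 N) 2), IsNewformOf W f →
        coeff 1 (padicLFunction f (unitRoot W p : ℚ_[p])) ≠ 0 := by
  sorry

/-! ## Stub statements by name -/

namespace Statement

/-- Statement of `stub_schneiderRankOne`. -/
abbrev stub_schneiderRankOne : Prop := type_of% @HeightSide.stub_schneiderRankOne
/-- Statement of `stub_padicGrossZagierReduction`. -/
abbrev stub_padicGrossZagierReduction : Prop := type_of% @HeightSide.stub_padicGrossZagierReduction
/-- Statement of `stub_smallPrimes`. -/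
abbrev stub_smallPrimes : Prop := type_of% @HeightSide.stub_smallPrimes

end Statement

/-! ## The composition (sorry-free) -/

/-- **Main range `5 ≤ p`**: H feeds R, giving `coeff₁ L_p ≠ 0`. -/
theorem coeff_one_ne_zero_of_height (hH : Statement.stub_schneiderRankOne)
    (hR : Statement.stub_padicGrossZagierReduction)
    (W : WeierstrassCurve ℚ) [W.IsElliptic] [W.IsGloballyMinimal] (p : ℕ) [Fact p.Prime]
    (hp : 5 ≤ p) (hord : IsOrdinaryAt W p) (hr : W.analyticRank = 1)
    {N : ℕ} [NeZero N] (f : CuspForm (Gamma0 N) 2) (hf : IsNewformOf W f) :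
    coeff 1 (padicLFunction f (unitRoot W p : ℚ_[p])) ≠ 0 :=
  hR W p hp hord hr (hH W p hp hord hr) f hf

/-- **`PAdicOrderRankOneR4_of`** — the three stub STATEMENTS imply the crux, BY NAME: in analytic rank one at any
good ordinary `p` the landed Negative lemma `order_eq_one_iff_coeff_one_ne_zero` (from S1 `1 ≤ ord`, p97073) turns
`ord_T L_p = 1` into `coeff₁ ≠ 0`, which is R ∘ H for `5 ≤ p` and S for `p < 5`. -/
theorem PAdicOrderRankOneR4_of (hH : Statement.stub_schneiderRankOne)
    (hR : Statement.stub_padicGrossZagierReduction) (hS : Statement.stub_smallPrimes) :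
    PAdicOrderRankOneR4 := by
  intro W _ _ p _ hord hr N _ f hf
  refine (Summit.BirchSwinnertonDyer.BirchSwinnertonDyer.Theorems.PAdicOrderRankOneR4.Negative.order_eq_one_iff_coeff_one_ne_zero
    W p hord hr f hf).mpr ?_
  by_cases hp : 5 ≤ p
  · exact coeff_one_ne_zero_of_height hH hR W p hp hord hr f hf
  · exact hS W p (by omega) hord hr f hf

/-- The crux along this line (route `PAdicOrderV2` decl, by name), MODULO the three open registered stubs. -/
theorem PAdicOrderRankOneR4_proofV2 : PAdicOrderRankOneR4 :=
  PAdicOrderRankOneR4_of stub_schneiderRankOne stub_padicGrossZagierReduction stub_smallPrimes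

/-- Same composition concluding the byte-identical decl of the superseded route `PAdicOrder` (the crux item
stmt-BirchSwinnertonDyer-0515 is shared by both routes; the two `def`s have the same body, so this is `_of` up to
delta). -/
theorem PAdicOrderRankOneR4_of' (hH : Statement.stub_schneiderRankOne)
    (hR : Statement.stub_padicGrossZagierReduction) (hS : Statement.stub_smallPrimes) :
    Summit.BirchSwinnertonDyer.BirchSwinnertonDyer.Theses.PAdicOrder.PAdicOrderRankOneR4 :=
  fun W _ _ p _ hord hr N _ f hf => PAdicOrderRankOneR4_of hH hR hS W p hord hr f hf

/-- The crux along this line (shared decl of route `PAdicOrder`, as the skeleton gate indexes it), MODULO the three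
open registered stubs. -/
theorem PAdicOrderRankOneR4_proof :
    Summit.BirchSwinnertonDyer.BirchSwinnertonDyer.Theses.PAdicOrder.PAdicOrderRankOneR4 :=
  PAdicOrderRankOneR4_of' stub_schneiderRankOne stub_padicGrossZagierReduction stub_smallPrimes

end Summit.BirchSwinnertonDyer.BirchSwinnertonDyer.Cruxes.PAdicOrderRankOneR4.HeightSide

end
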